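import Literature.Geometry.DiscreteGeometry.KissingSearchNumerics
import Mathlib.Analysis.SpecialFunctions.Trigonometric.Basic
import HarnessLib

/-!
# Basic lemmas on the abstract structure of the kissing growth search and on realized states

Topic `Literature/Geometry/DiscreteGeometry`; provefact brick for `Hales2012_contactGraphTame` /
`Hales2012_contactGraphFccOrHcp` (after `KissingSearchCheck.lean`, `KissingSearchDefs.lean`,
`KissingSearchNumerics.lean`).  The structure `KConf`, its conclusion `KConf.Concl`, the codes
`TriValid / tset`, the semantics `DomSem` and `Realizes` are DEFINED in `KissingSearchDefs.lean`;
everything here is PROVED: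

* Part B — triangle codes (`tv_triCode`, `sortTri_valid`, `tmem_iff`, `others_spec`,
  `sortTri_eq_of_valid`), side indices (`sIdx`), and the accessor lemmas of
  `St.gdom / St.sdom / St.gsc / St.addTri`;
* Part C — cells (`gridPt_mono`, `symMem_cell_iff`, `exists_symMem`, `exists_cell`);
* Part D — **`slot_encl`**: in a realized state the bracket `s.slotBr t v` of a placed triangle
  encloses its true angle `M.ang (tset t) v`.

## References
* T. C. Hales, arXiv:1209.6043 (2012), Definition 1, Theorem 3, Lemmas 7–9. [`Hales2012`]
* R. E. Moore, *Interval Analysis* (1966), Theorem 3.1. [`Moore1966`]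
-/

namespace Literature.Geometry.DiscreteGeometry

namespace KissingSearch

open Real Literature.Analysis.ValidatedNumerics KissingLP NonemptyInterval Finset




/-! ### Part B. Triangle codes, side indices, accessors -/



/-- Decoding `triCode`. [folklore] -/
theorem tv_triCode {a b c : ℕ} (hb : b < 16) (hc : c < 16) :
    tv0 (triCode a b c) = a ∧ tv1 (triCode a b c) = b ∧ tv2 (triCode a b c) = c := by
  unfold tv0 tv1 tv2 triCode
  refine ⟨?_, ?_, ?_⟩ <;> omega

/-- `sortTri` of three distinct labels `< 12` is valid and has vertex set `{a, b, c}`. [folklore] -/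
theorem sortTri_valid {a b c : ℕ} (ha : a < 12) (hb : b < 12) (hc : c < 12) (hab : a ≠ b)
    (hac : a ≠ c) (hbc : b ≠ c) :
    TriValid (sortTri a b c) ∧ tset (sortTri a b c) = {a, b, c} := by
  unfold sortTri
  set lo := min a (min b c) with hlo
  set hi := max a (max b c) with hhi
  set mid := a + b + c - lo - hi with hmid
  have hlo' : lo = a ∨ lo = b ∨ lo = c := by omega
  have hhi' : hi = a ∨ hi = b ∨ hi = c := by omega
  have hmid' : (mid = a ∨ mid = b ∨ mid = c) ∧ lo < mid ∧ mid < hi := by omega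
  have hlt : lo < mid ∧ mid < hi ∧ hi < 12 := by omega
  obtain ⟨e0, e1, e2⟩ := tv_triCode (a := lo) (b := mid) (c := hi) (by omega) (by omega)
  refine ⟨⟨by rw [e0, e1]; exact hlt.1, by rw [e1, e2]; exact hlt.2.1, by rw [e2]; exact hlt.2.2,
    by rw [e0, e1, e2]⟩, ?_⟩
  unfold tset
  rw [e0, e1, e2]
  ext x
  simp only [Finset.mem_insert, Finset.mem_singleton]
  omega

/-- Membership test agrees with the vertex set. [folklore] -/
theorem tmem_iff {t v : ℕ} : tmem t v = true ↔ v ∈ tset t := by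
  unfold tmem tset
  simp only [Bool.or_eq_true, beq_iff_eq, Finset.mem_insert, Finset.mem_singleton]
  tauto

/-- `tmem` as a decidable proposition. [folklore] -/
theorem tmem_eq_true_iff {t v : ℕ} : (tmem t v) ↔ v ∈ tset t := tmem_iff

/-- The vertex set of a valid code has three elements. [folklore] -/
theorem card_tset {t : ℕ} (ht : TriValid t) : (tset t).card = 3 := by
  unfold tset
  obtain ⟨h1, h2, -, -⟩ := ht
  rw [Finset.card_insert_of_notMem, Finset.card_insert_of_notMem, Finset.card_singleton]
  · simp only [Finset.mem_singleton]; omega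
  · simp only [Finset.mem_insert, Finset.mem_singleton]; omega

/-- Labels of a valid code are `< 12`. [folklore] -/
theorem lt_of_mem_tset {t v : ℕ} (ht : TriValid t) (hv : v ∈ tset t) : v < 12 := by
  unfold tset at hv
  obtain ⟨h1, h2, h3, -⟩ := ht
  simp only [Finset.mem_insert, Finset.mem_singleton] at hv
  omega

/-- **Specification of `others`**: for `v` a vertex of a valid code, `v` and the two others are
pairwise distinct and form the vertex set. [folklore] -/
theorem others_spec {t v : ℕ} (ht : TriValid t) (hv : v ∈ tset t) :
    v ≠ (others t v).1 ∧ v ≠ (others t v).2 ∧ (others t v).1 ≠ (others t v).2 ∧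
      tset t = {v, (others t v).1, (others t v).2} := by
  obtain ⟨h1, h2, h3, -⟩ := ht
  unfold tset at hv ⊢
  simp only [Finset.mem_insert, Finset.mem_singleton] at hv
  unfold others
  rcases hv with rfl | rfl | rfl
  · rw [if_pos rfl]
    exact ⟨by omega, by omega, by omega, rfl⟩
  · rw [if_neg (by omega), if_pos rfl]
    refine ⟨by omega, by omega, by omega, ?_⟩
    ext x; simp only [Finset.mem_insert, Finset.mem_singleton]; omega
  · rw [if_neg (by omega), if_neg (by omega)]
    refine ⟨by omega, by omega, by omega, ?_⟩
    ext x; simp only [Finset.mem_insert, Finset.mem_singleton]; omega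

/-- A valid code equals the sorted code of its vertices (in any order of two of them with the
third). [folklore] -/
theorem sortTri_eq_of_valid {t v a c : ℕ} (ht : TriValid t) (h : tset t = {v, a, c})
    (hva : v ≠ a) (hvc : v ≠ c) (hac : a ≠ c) : sortTri v a c = t := by
  obtain ⟨h1, h2, h3, h4⟩ := ht
  have hv : v ∈ tset t := by rw [h]; simp
  have ha : a ∈ tset t := by rw [h]; simp
  have hc : c ∈ tset t := by rw [h]; simp
  have hv12 := lt_of_mem_tset ⟨h1, h2, h3, h4⟩ hv
  have ha12 := lt_of_mem_tset ⟨h1, h2, h3, h4⟩ ha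
  have hc12 := lt_of_mem_tset ⟨h1, h2, h3, h4⟩ hc
  obtain ⟨hval, hset⟩ := sortTri_valid hv12 ha12 hc12 hva hvc hac
  -- two valid codes with the same vertex set are equal
  have key : ∀ {s : ℕ}, TriValid s → tset s = tset t → s = t := by
    intro s hs hst
    obtain ⟨s1, s2, s3, s4⟩ := hs
    unfold tset at hst
    have m0 : tv0 s ∈ ({tv0 t, tv1 t, tv2 t} : Finset ℕ) := by rw [← hst]; simp
    have m1 : tv1 s ∈ ({tv0 t, tv1 t, tv2 t} : Finset ℕ) := by rw [← hst]; simp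
    have m2 : tv2 s ∈ ({tv0 t, tv1 t, tv2 t} : Finset ℕ) := by rw [← hst]; simp
    have n0 : tv0 t ∈ ({tv0 s, tv1 s, tv2 s} : Finset ℕ) := by rw [hst]; simp
    have n1 : tv1 t ∈ ({tv0 s, tv1 s, tv2 s} : Finset ℕ) := by rw [hst]; simp
    have n2 : tv2 t ∈ ({tv0 s, tv1 s, tv2 s} : Finset ℕ) := by rw [hst]; simp
    simp only [Finset.mem_insert, Finset.mem_singleton] at m0 m1 m2 n0 n1 n2
    have e0 : tv0 s = tv0 t := by omega
    have e1 : tv1 s = tv1 t := by omega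
    have e2 : tv2 s = tv2 t := by omega
    rw [s4, h4, e0, e1, e2]
  exact key hval (by rw [hset, h])

/-- Side indices are symmetric. [folklore] -/
theorem sIdx_comm (a b : ℕ) : sIdx a b = sIdx b a := by
  unfold sIdx; split_ifs <;> omega

/-- Side indices of labels `< 12` are `< 144`. [folklore] -/
theorem sIdx_lt {a b : ℕ} (ha : a < 12) (hb : b < 12) : sIdx a b < 144 := by
  unfold sIdx; split_ifs <;> omega

/-- Side indices determine the unordered pair (labels `< 12`). [folklore] -/
theorem sIdx_eq_iff {a b a' b' : ℕ} (ha : a < 12) (hb : b < 12) (ha' : a' < 12) (hb' : b' < 12) :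
    sIdx a b = sIdx a' b' ↔ (a = a' ∧ b = b') ∨ (a = b' ∧ b = a') := by
  unfold sIdx; split_ifs <;> omega

/-- For labels `< 12`, `sIdx a b / 12` and `sIdx a b % 12` are `min` and `max`. [folklore] -/
theorem sIdx_div_mod {a b : ℕ} (ha : a < 12) (hb : b < 12) :
    sIdx a b / 12 = min a b ∧ sIdx a b % 12 = max a b := by
  unfold sIdx; split_ifs <;> omega

section Accessors

variable {s : St}

/-- `sdom` does not touch the triangles. [folklore] -/
@[simp] theorem tris_sdom (a b r : ℕ) : (s.sdom a b r).tris = s.tris := rfl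
/-- `sdom` does not touch the side counts. [folklore] -/
@[simp] theorem sc_sdom (a b r : ℕ) : (s.sdom a b r).sc = s.sc := rfl
/-- `sdom` keeps the size of the domain array. [folklore] -/
@[simp] theorem size_dom_sdom (a b r : ℕ) : (s.sdom a b r).dom.size = s.dom.size := by
  unfold St.sdom; simp
/-- `gsc` after `sdom`. [folklore] -/
@[simp] theorem gsc_sdom (a b r p q : ℕ) : (s.sdom a b r).gsc p q = s.gsc p q := rfl

/-- Reading back the written domain. [folklore] -/
theorem gdom_sdom_self {a b r : ℕ} (h : sIdx a b < s.dom.size) : (s.sdom a b r).gdom a b = r := by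
  unfold St.gdom St.sdom
  simp only
  rw [Array.getD_eq_getD_getElem?, Array.getElem?_setIfInBounds_self_of_lt h, Option.getD_some]

/-- Reading another domain after a write. [folklore] -/
theorem gdom_sdom_of_ne {a b r p q : ℕ} (hne : sIdx p q ≠ sIdx a b) : (s.sdom a b r).gdom p q = s.gdom p q := by
  unfold St.gdom St.sdom
  simp only
  rw [Array.getD_eq_getD_getElem?, Array.getD_eq_getD_getElem?, Array.getElem?_setIfInBounds_ne (Ne.symm hne)]

/-- `gdom` is symmetric. [folklore] -/
theorem gdom_comm (s : St) (a b : ℕ) : s.gdom a b = s.gdom b a := by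
  unfold St.gdom; rw [sIdx_comm]

/-- `gsc` is symmetric. [folklore] -/
theorem gsc_comm (s : St) (a b : ℕ) : s.gsc a b = s.gsc b a := by
  unfold St.gsc; rw [sIdx_comm]

end Accessors

/-! ### Part C. Domain semantics, cells, realized states -/


/-- `gridPt` is monotone. [folklore] -/
theorem gridPt_mono {i j : ℕ} (h : i ≤ j) : gridPt i ≤ gridPt j := by
  unfold gridPt
  have hc : (0 : ℚ) ≤ (κ0 + 1 / 2) / K := by unfold κ0 K; norm_num
  have : (κ0 + 1 / 2) * (i : ℚ) / K ≤ (κ0 + 1 / 2) * (j : ℚ) / K := by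
    rw [mul_div_right_comm, mul_div_right_comm]
    exact mul_le_mul_of_nonneg_left (by exact_mod_cast h) hc
  linarith

/-- Membership in a cell `σ ≥ 1` is membership in `[gridPt (σ-1), gridPt σ]`. [folklore] -/
theorem symMem_cell_iff {σ : ℕ} (hσ : σ ≠ 0) {x : ℝ} :
    SymMem σ x ↔ ((gridPt (σ - 1) : ℚ) : ℝ) ≤ x ∧ x ≤ ((gridPt σ : ℚ) : ℝ) := by
  unfold SymMem symIv mkIv
  rw [if_neg hσ, mem_ratCast_iff]
  simp only
  rw [min_eq_left (gridPt_mono (Nat.sub_le σ 1)), max_eq_right (gridPt_mono (Nat.sub_le σ 1))]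

/-- The contact symbol's cell is `{1/2}`. [folklore] -/
theorem symMem_zero_iff {x : ℝ} : SymMem 0 x ↔ x = 1 / 2 := by
  unfold SymMem symIv mkIv
  simp only [↓reduceIte, mem_ratCast_iff, min_self, max_self]
  push_cast
  constructor
  · intro h; linarith [h.1, h.2]
  · intro h; rw [h]; exact ⟨le_rfl, le_rfl⟩

/-- **Locating the cell**: a real in `[gridPt (lo-1), gridPt hi]` with `1 ≤ lo ≤ hi` lies in the
cell of some `σ ∈ [lo, hi]`. [folklore] -/
theorem exists_cell : ∀ (n lo hi : ℕ) {x : ℝ}, hi = lo + n → 1 ≤ lo →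
    ((gridPt (lo - 1) : ℚ) : ℝ) ≤ x → x ≤ ((gridPt hi : ℚ) : ℝ) →
    ∃ σ, lo ≤ σ ∧ σ ≤ hi ∧ SymMem σ x
  | 0, lo, hi, x, hn, h1, hlo, hhi => by
    refine ⟨lo, le_rfl, by omega, ?_⟩
    rw [symMem_cell_iff (by omega)]
    exact ⟨hlo, by rw [hn, Nat.add_zero] at hhi; exact hhi⟩
  | n + 1, lo, hi, x, hn, h1, hlo, hhi => by
    by_cases hx : x ≤ ((gridPt lo : ℚ) : ℝ)
    · exact ⟨lo, le_rfl, by omega, (symMem_cell_iff (by omega)).2 ⟨hlo, hx⟩⟩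
    · obtain ⟨σ, h1', h2', h3'⟩ := exists_cell n (lo + 1) hi (by omega) (by omega)
        (by rw [Nat.add_sub_cancel]; exact (not_le.1 hx).le) hhi
      exact ⟨σ, by omega, h2', h3'⟩

/-- **From a domain code to a symbol**: a labelled side's Gram entry lies in the cell of a symbol
of its domain. [folklore] -/
theorem exists_symMem_of_domSem {r : ℕ} {x : ℝ} (h : DomSem r x) (hr : r ≠ UNL) :
    ValidDom r ∧ ∃ σ ∈ symsList r, SymMem σ x := by
  rcases h with h | ⟨rfl, hx⟩ | ⟨hv, hr0, -, hlo, hhi⟩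
  · exact absurd h hr
  · refine ⟨Or.inl rfl, 0, ?_, symMem_zero_iff.2 hx⟩
    unfold symsList; simp
  · refine ⟨hv, ?_⟩
    rcases hv with rfl | ⟨h1, h2, h3, -⟩
    · exact absurd rfl hr0
    · obtain ⟨σ, hs1, hs2, hs3⟩ := exists_cell (rHi r - rLo r) (rLo r) (rHi r) (by omega) h1 hlo hhi
      refine ⟨σ, ?_, hs3⟩
      unfold symsList
      rw [if_neg hr0, List.mem_range'_1]
      omega


/-! ### Part D. Brackets of placed slots enclose the true angles -/

/-- `κ₀ < 1/2`. [folklore] -/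
theorem κ0R_lt_half : κ0R < 1 / 2 := by
  unfold κ0R κ0; norm_num

/-- **The slot bracket encloses the angle.**  In a realized state, for a placed triangle `t` and
a vertex `v` of it, `Encl (s.slotBr t v) (M.ang (tset t) v)`. [cite: Moore1966, Theorem 3.1] -/
theorem slot_encl {M : KConf} {s : St} (hR : Realizes M s) {t : ℕ} (ht : t ∈ s.tris.toList)
    {v : ℕ} (hv : v ∈ tset t) : Encl (s.slotBr t v) (M.ang (tset t) v) := by
  have hval := hR.valid t ht
  obtain ⟨hva, hvb, hab, hset⟩ := others_spec hval hv
  set a := (others t v).1 with ha_def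
  set b := (others t v).2 with hb_def
  have hT : tset t ∈ M.T := hR.mem t ht
  have hv12 : v < 12 := lt_of_mem_tset hval hv
  have haT : a ∈ tset t := by rw [hset]; simp
  have hbT : b ∈ tset t := by rw [hset]; simp
  have ha12 : a < 12 := lt_of_mem_tset hval haT
  have hb12 : b < 12 := lt_of_mem_tset hval hbT
  -- the three sides are labelled, with valid domains enclosing the Gram entries
  have lva := hR.side_lab t ht v hv a haT hva
  have lvb := hR.side_lab t ht v hv b hbT hvb
  have lab := hR.side_lab t ht a haT b hbT hab
  obtain ⟨vda, σa, hσa, hxa⟩ := exists_symMem_of_domSem (hR.dom v a hv12 ha12 hva) lva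
  obtain ⟨vdb, σb, hσb, hxb⟩ := exists_symMem_of_domSem (hR.dom v b hv12 hb12 hvb) lvb
  obtain ⟨vdc, σc, hσc, hxc⟩ := exists_symMem_of_domSem (hR.dom a b ha12 hb12 hab) lab
  -- the basic bracket of the true cells encloses the angle
  have hcos := M.cos_law _ hT v hv a haT b hbT hva hvb hab
  have hP := M.circum _ hT v hv a haT b hbT hva hvb hab
  have hx1 := sq_lt_one_of_symMem (le_K_of_mem_symsList vda hσa) hxa
  have hy1 := sq_lt_one_of_symMem (le_K_of_mem_symsList vdb hσb) hxb
  have hbasic := basic_sound hxa hxb hxc hx1 hy1 hP (M.ang_nonneg _ _) (M.ang_le_pi _ _) hcos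
  rw [← btab_eq (lt_NS_of_mem_symsList vda hσa) (lt_NS_of_mem_symsList vdb hσb)
    (lt_NS_of_mem_symsList vdc hσc)] at hbasic
  have hC := rangeC_sound hσc hbasic
  have hBr := rangeBr_sound vda vdb vdc hσa hσb hC
  unfold St.slotBr
  exact hBr

end KissingSearch

end Literature.Geometry.DiscreteGeometry
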